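import Literature.MathematicalPhysics.QuantumFieldTheory.Balaban1983to89.B9

/-!
# `Balaban1983to89.B9Ineq343to345T` (file name without underscore per the gate's Literature path rule; the lead's word named it `B9Ineq344_345T`) — T. Bałaban, *Propagators for lattice gauge theories in a background field*,
# Commun. Math. Phys. **99** (1985) 389–434 [`Balaban1985BackgroundPropagators`, "B9"]: THE HÖLDER BLOCK (3.43)–(3.45)
# OF THEOREM 3.1 WITH THE U-TRANSPORTED DATA NORM OF (3.40) — a COMPANION module to `…Balaban1983to89.B9` (v4)

statement-level skeleton of published theorems with citation tags; proofs where landed; nothing here is a claim about the Yang–Mills mass gap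

CITATION HEADER (lean-in-tree rule).  Cell `lit-balaban`, seat `lit-balaban-r06` gen 72 ([B9] page owner), on the cell lead's
OWNER WORD (lit-balaban lead g38, 2026-08-29T23:05Z, «LOCATED-22: GO (a′) COMPANION MODULE»; species located by pub-ymgap
dag-n06-c g20, ■ 23:01:13Z, ★ LOCATED-22, confirmed by r06 g72 23:02:42Z on the page side and the typed side).

THE PRINT (first-hand, text layer `paper:balaban1985-cmp99-background-propagators` p0009∕p0010; journal page = PDF + 388).
p. 397 l. 4–6: *«To formulate the regularity and decay properties we have to introduce several norms. They are identical to the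
norms used in [3, 4], e.g., given by (1.108), (1.109), but the derivatives there have to be replaced by the corresponding covariant
derivatives determined by a configuration U.»*; (3.40) p. 397: *«‖A‖_α = max_μ sup_{x,x′: |x−x′| ≦ 1} |R(U(Γ_{x,x′}))A_μ(x′) − A_μ(x)|
∕ |x − x′|^α, … where Γ_{x,x′} is a shortest contour connecting points x and x′. It is understood that the η-scale is used in the
above definitions. If we use another scale, then it is indicated explicitly by a superscript»*; (3.44)–(3.45) p. 398 bound
`|(∇_U G′(U)∇*_U λ)(x)|` and `‖ζ∇_U G′(U)∇*_U λ‖_β` by `B′₀(ε) e^{−δ₀d(y,y′)} (‖λ‖^{ξ′}_ε + |λ|)` and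
`B′₀(ε, β)(Lʲη)^{−β}(‖ζ‖_β + |ζ|) e^{−δ₀d(y,y′)} (‖λ‖^{ξ′}_{β+ε} + |λ|)`; p. 398 l. 19: *«All these inequalities are invariant with
respect to gauge transformations of U.»*  So print's DATA NORM ‖λ‖^{ξ′}_ε in (3.44)∕(3.45) is the COVARIANT (U-transported, adjoint
action `R(U(Γ_{x,x′}))`) Hölder norm of (3.40) on the `L^{−j′}` scale — it depends on the configuration `U`.

WHY THIS FILE (LOCATED-22).  In the reader file of record `…Balaban1983to89.B9` (pub-balaban, typing v4) the carrier field
`Geometry.holder : ℝ → Loc → ℝ` has no configuration argument (it cannot: `Geometry` is declared before `Backgrounds`), so the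
(3.44)∕(3.45) conjuncts of `B9.Ineq343_345` read the data norm through a U-BLIND functional, while the left-hand functionals
`KernelFamily.e4 U lam y`, `KernelFamily.h2 U lam β ζ` do carry `U`.  Within one family index `i` (fixed before `∀ U` in
`Thm31Printed` ∕ `Thm33Printed` ∕ `Thm34Printed`) the typed data norm therefore cannot vary with `U`: the v4 block is print-exact at
`U = 1` (Cor. 3.5's shape, transport trivial) and a DIFFERENT statement for `U ≠ 1`.  This companion module — NOT an edit of
`B9.lean` — states the same block with an explicit TRANSPORTED data norm `holderT : Cfg → ℝ → Loc → ℝ` and the three theorem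
frames over it, re-using `B9.Geometry`, `B9.Backgrounds`, `B9.KernelFamily`, `B9.Ineq342_346_347` BY NAME; at the constant
transport `holderT := fun _ => g.holder` every T-declaration IS the v4 one definitionally (`…_const_iff : … ↔ … := Iff.rfl`), so
nothing is duplicated and no importer of `B9.lean` is touched.  Consumers wanting the print-faithful (3.44)∕(3.45) take
`(h : Thm31PrintedT c35 geo bg Gp holderT)` with their own transported Hölder functional.

WHAT IS DECLARED (statement level; `def … : Prop` + three `Iff.rfl` bookkeeping theorems; no `instance`, no `notation`, no
`sorry`): `Ineq343_345T`, `ineq343_345T_const_iff`, `Thm31PrintedT`, `thm31PrintedT_const_iff`, `Thm33PrintedT`,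
`thm33PrintedT_const_iff`, `Thm34PrintedT`, `thm34PrintedT_const_iff`.  HONEST SCOPE: typed statements of the printed theorem
frames (hypothesis shapes), nothing of [B9] proved here; count-neutral; one finite-lattice bookkeeping item; nothing continuum ∕
OS ∕ mass gap ∕ Clay.
-/

namespace Literature.MathematicalPhysics.QuantumFieldTheory.Balaban1983to89.B9Ineq343to345T

open Literature.MathematicalPhysics.QuantumFieldTheory.Balaban1983to89.B9

variable {g : Geometry} {B : Backgrounds}

/-- **The Hölder inequalities (3.43)–(3.45) for one `U` with a U-TRANSPORTED data norm** (LOCATED-22 companion of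
`B9.Ineq343_345`): identical to the v4 block except that the data norm on the right of (3.44)∕(3.45) is
`holderT U ε λ` (print's ‖λ‖^{ξ′}_ε of (3.40), *«the derivatives there have to be replaced by the corresponding covariant
derivatives determined by a configuration U»*, p. 397) instead of the U-blind carrier field `g.holder ε λ`.  The (3.43) clause and
all support conditions (*«ζ ∈ C₀^∞(Δ̃(y)), y ∈ Λ_j, supp λ ⊂ Δ(y′)»* (3.43); *«x ∈ Δ(y), supp λ ⊂ Δ̃(y′), y′ ∈ Λ_{j′}, ξ′ = L^{−j′}»*
(3.44); *«ζ ∈ C₀^∞(Δ̃(y)), y ∈ Λ_j, ξ = L^{−j}, supp λ ⊂ Δ̃(y′), y′ ∈ Λ_{j′}»* (3.45)) are the v4 ones verbatim.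
[cite: Balaban1985BackgroundPropagators, (3.43)–(3.45) p.398, (3.40) p.397] -/
def Ineq343_345T (K : KernelFamily g B) (holderT : B.Cfg → ℝ → g.Loc → ℝ) (Bβ : ℝ → ℝ) (Bε : ℝ → ℝ)
    (Bεβ : ℝ → ℝ → ℝ) (δ₀ : ℝ) (U : B.Cfg) : Prop :=
  (∀ (β : ℝ) (lam : g.Loc) (ζ : g.Cut) (y y' : g.Site), 0 ≤ β → β < 1 → g.cutInT ζ y → g.suppIn lam y' →
      K.h1 U lam β ζ ≤ Bβ β * (g.len y) ^ (1 - β) * g.cutH β ζ * Real.exp (-(δ₀ * g.dist y y')) *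
        g.supNorm lam) ∧
  (∀ (ε : ℝ) (lam : g.Loc) (y y' : g.Site), 0 < ε → ε ≤ 1 → g.suppInT lam y' →
      K.e4 U lam y ≤ Bε ε * Real.exp (-(δ₀ * g.dist y y')) * (holderT U ε lam + g.supNorm lam)) ∧
  (∀ (ε β : ℝ) (lam : g.Loc) (ζ : g.Cut) (y y' : g.Site), 0 < ε → ε ≤ 1 → 0 ≤ β → β < 1 →
      g.cutInT ζ y → g.suppInT lam y' →
      K.h2 U lam β ζ ≤ Bεβ ε β * (g.len y) ^ (-β) * g.cutH β ζ * Real.exp (-(δ₀ * g.dist y y')) *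
        (holderT U (β + ε) lam + g.supNorm lam))

/-- Bookkeeping (LOCATED-22): at the CONSTANT transport `holderT := fun _ => g.holder` the T-block IS the v4 block `B9.Ineq343_345`,
definitionally — the companion duplicates nothing and the v4 statement is the `U`-blind special case.
[cite: Balaban1985BackgroundPropagators, (3.43)–(3.45) p.398] -/
theorem ineq343_345T_const_iff (K : KernelFamily g B) (Bβ Bε : ℝ → ℝ) (Bεβ : ℝ → ℝ → ℝ) (δ₀ : ℝ) (U : B.Cfg) :
    Ineq343_345T K (fun _ => g.holder) Bβ Bε Bεβ δ₀ U ↔ Ineq343_345 K Bβ Bε Bεβ δ₀ U :=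
  Iff.rfl

/-- **Theorem 3.1 (pp. 397–398), T-frame**: the v4 frame `B9.Thm31Printed` (*«There exist positive constants M₁, δ₀, a₀, B₀ dependent
on d and L only, a constant B₀(β) … such that for M ≧ M₁ and for an arbitrary configuration U satisfying the regularity condition
(3.35) with Mα₀ ≦ a₀, the operator G′(U) (a = 1) satisfies the inequalities (3.42)–(3.47) … All these inequalities are invariant with
respect to gauge transformations of U.»*) with the Hölder block read through a TRANSPORTED data-norm family
`holderT i : (bg i).Cfg → ℝ → (geo i).Loc → ℝ` (print's ‖·‖^{ξ′}_ε of (3.40), configuration-dependent).  Quantifier order as in v4: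
constants BEFORE `i`, `U`. [cite: Balaban1985BackgroundPropagators, Thm 3.1 (3.42)–(3.47) pp.397–398, (3.40) p.397] -/
def Thm31PrintedT {I : Type} (c35 : ℝ) (geo : I → Geometry) (bg : I → Backgrounds)
    (Gp : ∀ i, KernelFamily (geo i) (bg i)) (holderT : ∀ i, (bg i).Cfg → ℝ → (geo i).Loc → ℝ) : Prop :=
  ∃ M₁ δ₀ a₀ B₀ : ℝ, ∃ Bβ Bε : ℝ → ℝ, ∃ Bεβ : ℝ → ℝ → ℝ,
    0 < M₁ ∧ 0 < δ₀ ∧ 0 < a₀ ∧ 0 < B₀ ∧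
    ∀ i : I, M₁ ≤ (geo i).M → ∀ α₀ : ℝ, 0 < α₀ → (geo i).M * α₀ ≤ a₀ →
      ∀ U : (bg i).Cfg, (bg i).Reg335 c35 α₀ U →
        Ineq342_346_347 (Gp i) B₀ δ₀ U ∧ Ineq343_345T (Gp i) (holderT i) Bβ Bε Bεβ δ₀ U

/-- Bookkeeping: `Thm31PrintedT` at the constant transport IS `B9.Thm31Printed`. [cite: Balaban1985BackgroundPropagators, Thm 3.1 pp.397–398] -/
theorem thm31PrintedT_const_iff {I : Type} (c35 : ℝ) (geo : I → Geometry) (bg : I → Backgrounds)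
    (Gp : ∀ i, KernelFamily (geo i) (bg i)) :
    Thm31PrintedT c35 geo bg Gp (fun i _ => (geo i).holder) ↔ Thm31Printed c35 geo bg Gp :=
  Iff.rfl

/-- **Theorem 3.3 (p. 399), T-frame**: the v4 frame `B9.Thm33Printed` (*«Under the assumptions of Theorem 3.1, and with the constants
described there, the operator G(U) (a = 1) satisfies the inequalities (3.42)–(3.47), with G′(U) replaced by G(U) and λ replaced by a
function J defined at bonds of the lattice T_η, or Ω₀, and with values in 𝔤.»*) for the two kernel families `Gp`, `GA`, both Hölder
blocks read through the transported data-norm family `holderT`. [cite: Balaban1985BackgroundPropagators, Thm 3.3 p.399, (3.40) p.397] -/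
def Thm33PrintedT {I : Type} (c35 : ℝ) (geo : I → Geometry) (bg : I → Backgrounds)
    (Gp GA : ∀ i, KernelFamily (geo i) (bg i)) (holderT : ∀ i, (bg i).Cfg → ℝ → (geo i).Loc → ℝ) : Prop :=
  ∃ M₁ δ₀ a₀ B₀ : ℝ, ∃ Bβ Bε : ℝ → ℝ, ∃ Bεβ : ℝ → ℝ → ℝ,
    0 < M₁ ∧ 0 < δ₀ ∧ 0 < a₀ ∧ 0 < B₀ ∧
    ∀ i : I, M₁ ≤ (geo i).M → ∀ α₀ : ℝ, 0 < α₀ → (geo i).M * α₀ ≤ a₀ →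
      ∀ U : (bg i).Cfg, (bg i).Reg335 c35 α₀ U →
        (Ineq342_346_347 (Gp i) B₀ δ₀ U ∧ Ineq343_345T (Gp i) (holderT i) Bβ Bε Bεβ δ₀ U) ∧
        (Ineq342_346_347 (GA i) B₀ δ₀ U ∧ Ineq343_345T (GA i) (holderT i) Bβ Bε Bεβ δ₀ U)

/-- Bookkeeping: `Thm33PrintedT` at the constant transport IS `B9.Thm33Printed`. [cite: Balaban1985BackgroundPropagators, Thm 3.3 p.399] -/
theorem thm33PrintedT_const_iff {I : Type} (c35 : ℝ) (geo : I → Geometry) (bg : I → Backgrounds)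
    (Gp GA : ∀ i, KernelFamily (geo i) (bg i)) :
    Thm33PrintedT c35 geo bg Gp GA (fun i _ => (geo i).holder) ↔ Thm33Printed c35 geo bg Gp GA :=
  Iff.rfl

/-- **Theorem 3.4 (p. 400), T-frame**: the v4 frame `B9.Thm34Printed` (*«There exists a positive constant a₁ such that the operators
G′(U), (Q′(U)G′²(U)Q′*(U))⁻¹, R(U), G(U) extend to configurations U′U for α₁ ≦ a₁ as analytic functions of A. The extended operators
satisfy all the inequalities of Theorems 3.1–3.3 correspondingly.»*) with the Hölder blocks at the extended configuration `U′U` read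
through the transported data-norm family `holderT` (evaluated at `(bg i).mul U′ U`). [cite: Balaban1985BackgroundPropagators, Thm 3.4 p.400, (3.40) p.397] -/
def Thm34PrintedT {I : Type} (c35 : ℝ) (geo : I → Geometry) (bg : I → Backgrounds)
    (Gp GA : ∀ i, KernelFamily (geo i) (bg i))
    (IsAnalyticExt : ∀ i, KernelFamily (geo i) (bg i) → (bg i).Cfg → ℝ → Prop)
    (holderT : ∀ i, (bg i).Cfg → ℝ → (geo i).Loc → ℝ) : Prop :=
  ∃ a₁ M₁ δ₀ a₀ B₀ : ℝ, ∃ Bβ Bε : ℝ → ℝ, ∃ Bεβ : ℝ → ℝ → ℝ,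
    0 < a₁ ∧ 0 < M₁ ∧ 0 < δ₀ ∧ 0 < a₀ ∧ 0 < B₀ ∧
    ∀ i : I, M₁ ≤ (geo i).M → ∀ α₀ α₁ : ℝ, 0 < α₀ → (geo i).M * α₀ ≤ a₀ → 0 < α₁ → α₁ ≤ a₁ →
      ∀ U : (bg i).Cfg, (bg i).Reg335 c35 α₀ U →
        IsAnalyticExt i (Gp i) U α₁ ∧ IsAnalyticExt i (GA i) U α₁ ∧
        ∀ U' : (bg i).Cfg, (bg i).Cplx337 α₁ U U' →
          Ineq342_346_347 (Gp i) B₀ δ₀ ((bg i).mul U' U) ∧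
            Ineq343_345T (Gp i) (holderT i) Bβ Bε Bεβ δ₀ ((bg i).mul U' U) ∧
          Ineq342_346_347 (GA i) B₀ δ₀ ((bg i).mul U' U) ∧
            Ineq343_345T (GA i) (holderT i) Bβ Bε Bεβ δ₀ ((bg i).mul U' U)

/-- Bookkeeping: `Thm34PrintedT` at the constant transport IS `B9.Thm34Printed`. [cite: Balaban1985BackgroundPropagators, Thm 3.4 p.400] -/
theorem thm34PrintedT_const_iff {I : Type} (c35 : ℝ) (geo : I → Geometry) (bg : I → Backgrounds)
    (Gp GA : ∀ i, KernelFamily (geo i) (bg i))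
    (IsAnalyticExt : ∀ i, KernelFamily (geo i) (bg i) → (bg i).Cfg → ℝ → Prop) :
    Thm34PrintedT c35 geo bg Gp GA IsAnalyticExt (fun i _ => (geo i).holder) ↔
      Thm34Printed c35 geo bg Gp GA IsAnalyticExt :=
  Iff.rfl

end Literature.MathematicalPhysics.QuantumFieldTheory.Balaban1983to89.B9Ineq343to345T
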